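import Summits.CriticalPhenomena.SAWScalingLimit.Theorems.SAWLoopFugacityFlowIsingBoundaryRatioFrameDefs
import Summits.CriticalPhenomena.SAWScalingLimit.Theorems.SAWLoopFugacityFlowIsingBoundaryRatioChartAnnulusSeparation
import HarnessLib

/-!
# The adjacency axiom of the chart frame holds for small mesh (line `fk-anchor-transfer`, GEO-1)
(crux `SAWLoopFugacityFlow.IsingBoundaryRatio`, stmt-CriticalPhenomena-10650)

For a Dobrushin domain `(D; a, b)` with chordal chart `φ : ℍ → D` (`φ → a` at `0`), `ε, η > 0`,
there is a chart ceiling `R > 0` such that for all small mesh sizes `δ > 0` and every finite volume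
`(G, Λ)` agreeing locally with the mesh graph `Ω_δ` in the ball `B(a, ε)`: along any edge of
`G.comap Subtype.val` on `↥Λ` issuing from a mesh site in `B(a, ε)` of chart radius `‖φ⁻¹(δu)‖ < R`
one reaches a mesh site in `B(a, ε)` whose chart radius differs by less than `η`. This is the field
`adj_good` of the chart frame `chartFrame D φ ε δ Λ (G.comap Subtype.val) η R …` (file `…FrameDefs`).

Proof. (a) From the boundary value `φ → a` at `0`: points of `D` of small chart radius are close to
`a` (`exists_forall_dist_lt_of_norm_symm_lt`), so a good vertex of chart radius `< R` has its mesh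
point in `B(a, ε/2)`. (b) Local agreement turns the edge into a step of `Ω_δ`, whose endpoints have
mesh points in `D` at distance `≤ δ < ε/2`; hence the other endpoint is a mesh site in `B(a, ε)`.
(c) The capped chart radius `min ‖φ⁻¹ ·‖ (R + η)` is uniformly continuous on `D`
(`exists_forall_dist_min_norm_symm_lt`); for `δ` below its modulus at `η` the two capped radii differ
by `< η`, and since the first is `< R` both caps are inactive. Folklore bookkeeping; no new definitions.
-/

noncomputable section

open scoped Classical Topology
open Filter Set Metric SimpleGraph
open Literature.Probability.LatticeModels Literature.Probability.RandomPlanarGeometry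
open UpperHalfPlane (upperHalfPlaneSet)

namespace Summit.CriticalPhenomena.SAWScalingLimit.Theorems.IsingBoundaryRatio

/-- **Small chart radius means close to the marked point.** For a chordal uniformizing map `φ` of
the Dobrushin domain `(D; a, b)` and `ε > 0` there is `R > 0` such that every `z ∈ D` with
`‖φ⁻¹ z‖ < R` satisfies `dist z a < ε`: the boundary value `φ → a` at `0` applied at `φ⁻¹ z ∈ ℍ`,
using `φ (φ⁻¹ z) = z`. [folklore] -/
theorem exists_forall_dist_lt_of_norm_symm_lt {D : DobrushinDomain}
    {φ : ConformalEquiv upperHalfPlaneSet D.carrier} (hφ : D.IsChordalUniformizing φ) {ε : ℝ}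
    (hε : 0 < ε) :
    ∃ R : ℝ, 0 < R ∧ ∀ z ∈ D.carrier, ‖φ.symm z‖ < R → dist z (D.pt 0) < ε := by
  have h : Tendsto φ (𝓝[upperHalfPlaneSet] 0) (𝓝 (D.pt 0)) := hφ.1
  obtain ⟨R, hR, h⟩ := Metric.tendsto_nhdsWithin_nhds.1 h ε hε
  refine ⟨R, hR, fun z hz hzR => ?_⟩
  have key := h (φ.symm_mapsTo hz) (by rwa [dist_zero_right])
  rwa [φ.apply_symm_apply hz] at key

/-- **The adjacency axiom of the chart frame holds eventually** (registered stub GEO-1 of the line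
`fk-anchor-transfer`). For `ε, η > 0` there is `R > 0` such that for all small `δ > 0`, every
finite volume `(G, Λ)` agreeing locally with `Ω_δ` in `B(a, ε)`, every edge `e` of
`G.comap Subtype.val` and `u, v ∈ e`: if `u` is a mesh site with mesh point in `B(a, ε)` and chart
radius `< R`, then so is `v` (mesh site in the ball) and the chart radii of `u` and `v` differ by
`< η`. Local agreement makes the edge a step of `Ω_δ` (mesh points in `D`, `δ` apart), the boundary
value of `φ` at `0` puts `δu` in `B(a, ε/2)`, and the uniform continuity of the capped chart radius
`min ‖φ⁻¹ ·‖ (R + η)` on `D` bounds the variation of the radius. [folklore] -/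
theorem eventually_chartFrame_adj :
    ∀ (D : DobrushinDomain) (φ : ConformalEquiv upperHalfPlaneSet D.carrier), D.IsChordalUniformizing φ →
    ∀ (ε η : ℝ), 0 < ε → 0 < η → ∃ R : ℝ, 0 < R ∧ ∀ᶠ δ in 𝓝[>] (0 : ℝ),
      ∀ (G : SimpleGraph (Site 2)) [G.LocallyFinite] (Λ : Finset (Site 2)),
        LocalAgreement D.carrier (D.pt 0) ε δ G Λ →
        ∀ e ∈ (G.comap (Subtype.val : ↥Λ → Site 2)).edgeFinset, ∀ u ∈ e, ∀ v ∈ e,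
          (u.1 ∈ meshDomain D.carrier δ ∧ meshPoint δ u.1 ∈ Metric.ball (D.pt 0) ε) →
          ‖φ.symm (meshPoint δ u.1)‖ < R →
            (v.1 ∈ meshDomain D.carrier δ ∧ meshPoint δ v.1 ∈ Metric.ball (D.pt 0) ε) ∧
              |‖φ.symm (meshPoint δ v.1)‖ - ‖φ.symm (meshPoint δ u.1)‖| < η := by
  intro D φ hφ ε η hε hη
  obtain ⟨R, hR, hRε⟩ := exists_forall_dist_lt_of_norm_symm_lt hφ (half_pos hε)
  obtain ⟨η₁, hη₁, hcont⟩ := exists_forall_dist_min_norm_symm_lt hφ (R + η) hη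
  refine ⟨R, hR, ?_⟩
  filter_upwards [Ioo_mem_nhdsGT (lt_min hη₁ (half_pos hε))] with δ hδ G _ Λ hLA e he u hu v hv
    hug huR
  by_cases huv : u = v
  · subst huv
    refine ⟨hug, ?_⟩
    rwa [sub_self, abs_zero]
  -- the edge is a step of `Ω_δ`
  have hadj : (G.comap (Subtype.val : ↥Λ → Site 2)).Adj u v := by
    rw [SimpleGraph.mem_edgeFinset, (Sym2.mem_and_mem_iff huv).1 ⟨hu, hv⟩] at he
    exact he
  have hGadj : G.Adj u.1 v.1 := hadj
  have hΩadj : (discreteDomainGraph D.carrier δ).Adj u.1 v.1 := (hLA u.1 u.2 hug.2 v.1).1.1 hGadj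
  obtain ⟨hzu, hzv, hd⟩ := meshPoint_mem_of_discreteDomainGraph_adj hΩadj
  have hvmesh : v.1 ∈ meshDomain D.carrier δ := (discreteDomainGraph_adj_iff.1 hΩadj).2.2
  have hd' : dist (meshPoint δ v.1) (meshPoint δ u.1) < min η₁ (ε / 2) := by
    rw [_root_.dist_comm]
    refine hd.trans_lt ?_
    rw [abs_of_pos hδ.1]
    exact hδ.2
  -- the mesh point of `u` is `ε/2`-close to `a`, hence that of `v` is `ε`-close
  have hu2 : dist (meshPoint δ u.1) (D.pt 0) < ε / 2 := hRε _ hzu huR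
  refine ⟨⟨hvmesh, ?_⟩, ?_⟩
  · rw [Metric.mem_ball]
    calc dist (meshPoint δ v.1) (D.pt 0)
        ≤ dist (meshPoint δ v.1) (meshPoint δ u.1) + dist (meshPoint δ u.1) (D.pt 0) :=
          _root_.dist_triangle _ _ _
      _ < ε / 2 + ε / 2 := add_lt_add (hd'.trans_le (min_le_right _ _)) hu2
      _ = ε := add_halves ε
  -- the capped chart radii differ by `< η`, and both caps are inactive
  · have key := hcont _ hzv _ hzu (hd'.trans_le (min_le_left _ _))
    have huRη : ‖φ.symm (meshPoint δ u.1)‖ ≤ R + η := (huR.trans (lt_add_of_pos_right R hη)).le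
    rw [Real.dist_eq, min_eq_left huRη] at key
    have h1 : min ‖φ.symm (meshPoint δ v.1)‖ (R + η) < R + η := by
      have h2 := (abs_lt.1 key).2
      linarith
    rwa [min_eq_left ((min_lt_iff.1 h1).resolve_right (lt_irrefl _)).le] at key

end Summit.CriticalPhenomena.SAWScalingLimit.Theorems.IsingBoundaryRatio

end
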